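import Summits.AtomisticToContinuum.HydrodynamicLimit.Theorems.ImplosionDichotomyTypeOneThm12Rates
import Summits.AtomisticToContinuum.HydrodynamicLimit.Theorems.ImplosionDichotomyPolynomialCompressionTypeOne
import Literature.Analysis.FluidPDE.CompressibleEulerLocalExistence

/-!
# `TypeOneIdealImplosion` from the BCG profile

Closing file (conditional form) for the support item `TypeOneIdealImplosion`
(stmt-AtomisticToContinuum-15146) of the route `ImplosionDichotomy`
(`AtomisticToContinuum/HydrodynamicLimit`) — literally stub 1 `stub_typeOneImplosion` of the line
`log-lipschitz-budget` of the crux `PolynomialCompression`: smooth positive profiles on `𝕋³` and a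
classical σ = 0 (monatomic ideal gas) solution on `[0, T₁)` with unit-mass isentropic data and the
four rate clauses (Type I, polynomial bounds on the derivatives of order `≤ 6`, polynomial density
floor, power-law core growth).

* `typeOneIdealImplosion_of_thm11_of_lwp` — the item's signature, CONDITIONALLY on the two named
  Literature facts `BuckmasterCaolaboraGomezserrano2025_thm11_monatomic` (the `γ = 5/3`
  self-similar profile of Buckmaster–Cao-Labora–Gómez-Serrano, Thm 1.1) and
  `CompressibleEulerLocalWellPosedness` (Majda 1984, Thm 2.1): the composition of
  `thm12_rates_of_thm11_of_lwp` (`…TypeOneThm12Rates`: exact self-similar core, backward exterior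
  solution, domain of dependence, glue, rates) with the landed unit-mass rescaling and ideal-gas
  bridge `stub_typeOneImplosion_of_rates` (`…PolynomialCompressionTypeOne`);
* `typeOneIdealImplosion_of_thm11` — the same, CONDITIONALLY on the BCG profile ALONE: the local
  well-posedness hypothesis is DISCHARGED by the tree theorem
  `Literature.Analysis.FluidPDE.CompressibleEulerLocalWellPosedness_holds`
  (`CompressibleEulerLocalExistence.lean`: Majda 1984 Thm 2.1 on `𝕋³`, from the symmetric form and
  the local existence theorem for quasilinear symmetric hyperbolic systems). The remaining input,
  the `γ = 5/3` profile of Buckmaster–Cao-Labora–Gómez-Serrano (computer-assisted in print), is the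
  one open hypothesis of the item.

The route file `Theses/ImplosionDichotomy.lean` (rev 8) does not render a decl
`TypeOneIdealImplosion`; the theorem is therefore stated with the item's ledger signature verbatim.
-/

noncomputable section

namespace Summit.AtomisticToContinuum.HydrodynamicLimit.Theorems

open Set MeasureTheory
open Literature.MathematicalPhysics.KineticTheory
open Literature.Analysis.FunctionSpaces

/-- **`TypeOneIdealImplosion` (stmt-AtomisticToContinuum-15146), conditionally on the BCG profile
and on local well-posedness**: smooth positive profiles `(a₀, u₀, θ₀)` on `𝕋³` and a classical
σ = 0 solution `(ρ₁, u₁, θ₁)` on `[0, T₁)` with data `(a₀/∫a₀, u₀, θ₀)`, isentropic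
(`θ₁ = Kρ₁^{2/3}`), with Type-I gradient bounds, polynomial bounds on all derivatives of order
`≤ 6`, a polynomial density floor and core growth `c(T₁ − t)^{−β}`, `β > 0`.
[cite: CaolaboraEtAl2025, Thm 1.2 + Rem 1.4 + Rem 1.5] [cite: BuckmasterCaolaboraGomezserrano2025, Thm 1.1]
[cite: Majda1984, Ch. 2 Thm 2.1] -/
theorem typeOneIdealImplosion_of_thm11_of_lwp
    (hBCG : Literature.Analysis.FluidPDE.BuckmasterCaolaboraGomezserrano2025_thm11_monatomic)
    (hLWP : Literature.Analysis.FluidPDE.CompressibleEulerLocalWellPosedness) :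
    ∃ (a₀ θ₀ : Literature.MathematicalPhysics.KineticTheory.T3 → ℝ)
      (u₀ : Literature.MathematicalPhysics.KineticTheory.T3 → Literature.MathematicalPhysics.KineticTheory.V3),
      Literature.Analysis.FunctionSpaces.Torus.IsSmooth a₀ ∧
      Literature.Analysis.FunctionSpaces.Torus.IsSmooth θ₀ ∧
      Literature.Analysis.FunctionSpaces.Torus.IsSmooth u₀ ∧ (∀ x, 0 < a₀ x) ∧ (∀ x, 0 < θ₀ x) ∧
      ∃ (T₁ K : ℝ) (ρ₁ θ₁ : ℝ → Literature.MathematicalPhysics.KineticTheory.T3 → ℝ)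
        (u₁ : ℝ → Literature.MathematicalPhysics.KineticTheory.T3 →
          Literature.MathematicalPhysics.KineticTheory.V3), 0 < T₁ ∧ 0 < K ∧
        Literature.MathematicalPhysics.KineticTheory.IsHardSphereEulerSolution 0 T₁ ρ₁ u₁ θ₁ ∧
        (∀ x, ρ₁ 0 x = a₀ x / ∫ y, a₀ y) ∧ u₁ 0 = u₀ ∧ θ₁ 0 = θ₀ ∧
        (∀ t ∈ Set.Ico 0 T₁, ∀ x, θ₁ t x = K * ρ₁ t x ^ (2 / 3 : ℝ)) ∧
        (∃ C : ℝ, ∀ t ∈ Set.Ico 0 T₁, ∀ x, ∀ i : Fin 3,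
          ‖Literature.Analysis.FunctionSpaces.Torus.partialDeriv i (u₁ t) x‖ ≤ C / (T₁ - t) ∧
          |Literature.Analysis.FunctionSpaces.Torus.partialDeriv i
              (fun y => ρ₁ t y ^ (1 / 3 : ℝ)) x| ≤ C / (T₁ - t)) ∧
        (∀ n : ℕ, n ≤ 6 → ∃ Cn pn : ℝ, ∀ t ∈ Set.Ico 0 T₁, ∀ y : EuclideanSpace ℝ (Fin 3),
          ‖iteratedFDeriv ℝ n (Literature.Analysis.FunctionSpaces.Torus.lift (ρ₁ t)) y‖ ≤
              Cn * (T₁ - t) ^ (-pn) ∧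
          ‖iteratedFDeriv ℝ n (Literature.Analysis.FunctionSpaces.Torus.lift (u₁ t)) y‖ ≤
              Cn * (T₁ - t) ^ (-pn)) ∧
        (∃ cl pl : ℝ, 0 < cl ∧ ∀ t ∈ Set.Ico 0 T₁, ∀ x, cl * (T₁ - t) ^ pl ≤ ρ₁ t x) ∧
        ∃ β c : ℝ, 0 < β ∧ 0 < c ∧ ∀ t ∈ Set.Ico 0 T₁, ∃ x, c * (T₁ - t) ^ (-β) ≤ ρ₁ t x :=
  stub_typeOneImplosion_of_rates (thm12_rates_of_thm11_of_lwp hBCG hLWP)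

/-- **`TypeOneIdealImplosion` (stmt-AtomisticToContinuum-15146), conditionally on the BCG profile
alone** (`typeOneIdealImplosion_of_thm11_of_lwp` with local well-posedness discharged by
`CompressibleEulerLocalWellPosedness_holds`). [cite: CaolaboraEtAl2025, Thm 1.2 + Rem 1.4 + Rem 1.5]
[cite: BuckmasterCaolaboraGomezserrano2025, Thm 1.1] [cite: Majda1984, Ch. 2 Thm 2.1] -/
theorem typeOneIdealImplosion_of_thm11
    (hBCG : Literature.Analysis.FluidPDE.BuckmasterCaolaboraGomezserrano2025_thm11_monatomic) :
    ∃ (a₀ θ₀ : Literature.MathematicalPhysics.KineticTheory.T3 → ℝ)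
      (u₀ : Literature.MathematicalPhysics.KineticTheory.T3 → Literature.MathematicalPhysics.KineticTheory.V3),
      Literature.Analysis.FunctionSpaces.Torus.IsSmooth a₀ ∧
      Literature.Analysis.FunctionSpaces.Torus.IsSmooth θ₀ ∧
      Literature.Analysis.FunctionSpaces.Torus.IsSmooth u₀ ∧ (∀ x, 0 < a₀ x) ∧ (∀ x, 0 < θ₀ x) ∧
      ∃ (T₁ K : ℝ) (ρ₁ θ₁ : ℝ → Literature.MathematicalPhysics.KineticTheory.T3 → ℝ)
        (u₁ : ℝ → Literature.MathematicalPhysics.KineticTheory.T3 →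
          Literature.MathematicalPhysics.KineticTheory.V3), 0 < T₁ ∧ 0 < K ∧
        Literature.MathematicalPhysics.KineticTheory.IsHardSphereEulerSolution 0 T₁ ρ₁ u₁ θ₁ ∧
        (∀ x, ρ₁ 0 x = a₀ x / ∫ y, a₀ y) ∧ u₁ 0 = u₀ ∧ θ₁ 0 = θ₀ ∧
        (∀ t ∈ Set.Ico 0 T₁, ∀ x, θ₁ t x = K * ρ₁ t x ^ (2 / 3 : ℝ)) ∧
        (∃ C : ℝ, ∀ t ∈ Set.Ico 0 T₁, ∀ x, ∀ i : Fin 3,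
          ‖Literature.Analysis.FunctionSpaces.Torus.partialDeriv i (u₁ t) x‖ ≤ C / (T₁ - t) ∧
          |Literature.Analysis.FunctionSpaces.Torus.partialDeriv i
              (fun y => ρ₁ t y ^ (1 / 3 : ℝ)) x| ≤ C / (T₁ - t)) ∧
        (∀ n : ℕ, n ≤ 6 → ∃ Cn pn : ℝ, ∀ t ∈ Set.Ico 0 T₁, ∀ y : EuclideanSpace ℝ (Fin 3),
          ‖iteratedFDeriv ℝ n (Literature.Analysis.FunctionSpaces.Torus.lift (ρ₁ t)) y‖ ≤
              Cn * (T₁ - t) ^ (-pn) ∧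
          ‖iteratedFDeriv ℝ n (Literature.Analysis.FunctionSpaces.Torus.lift (u₁ t)) y‖ ≤
              Cn * (T₁ - t) ^ (-pn)) ∧
        (∃ cl pl : ℝ, 0 < cl ∧ ∀ t ∈ Set.Ico 0 T₁, ∀ x, cl * (T₁ - t) ^ pl ≤ ρ₁ t x) ∧
        ∃ β c : ℝ, 0 < β ∧ 0 < c ∧ ∀ t ∈ Set.Ico 0 T₁, ∃ x, c * (T₁ - t) ^ (-β) ≤ ρ₁ t x :=
  typeOneIdealImplosion_of_thm11_of_lwp hBCG
    Literature.Analysis.FluidPDE.CompressibleEulerLocalWellPosedness_holds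

end Summit.AtomisticToContinuum.HydrodynamicLimit.Theorems

end
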